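import Mathlib
import HarnessLib
import Summits.Ventures.LatticeQCDFlow.Scoring.IMHAcceptanceRecordJumpVariance
import Summits.Ventures.LatticeQCDFlow.Scoring.IMHAcceptanceRecordConcentration
import Summits.Ventures.LatticeQCDFlow.Scoring.ChainHoeffding
import Summits.Ventures.LatticeQCDFlow.Scoring.ChainMeanSquareError
import Summits.Ventures.LatticeQCDFlow.Scoring.MarkovChainCLT

/-!
# The IMH acceptance record XII: the accepted stream certified from any start — Gaussian tails,
# bias, mean-square error and CLT at rate `ā` — and the sojourn-reweighted estimator of `π`

HONEST FRAMING: exact (Metropolis-corrected) sampling algorithms for lattice gauge theory; figures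
of merit are autocorrelation/cost numbers at stated couplings and volumes; no continuum-physics
claim.  This file is value-free (no number of ours appears) and nothing in it is cited as a fact.

Venture `LatticeQCDFlow` (cell pub-lqcd), topic `Scoring`; flow / samplers seat (GEN-47).  NEW WORK
(tree-internal).  VII (`…JumpKernel`) made the ACCEPTED configurations of the flow-MCMC kernel
`K = indepMH q w` a Markov chain with kernel `J̃ = imhJump q w`, minorised by its invariant tilt
`π̃ = imhTilt q w π` with constant the MEAN acceptance `ā = ∫ α dπ`, for EVERY weight; IX/X
identified the accepted stream from ANY start with the `J̃`-chain and proved geometric burn-in in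
acceptances; VIII (`…JumpVariance`) transferred `τ_int` between `K` and `J̃`.  Listed NOT CLAIMED
there: concentration / CLT for accepted-stream averages (X, XI) and "any statement about
estimators built from the accepted states" (VIII).  Below, `P̃_{μ₀}` is the path law of the
`J̃`-chain from ANY initial law `μ₀` (Mathlib's `Kernel.trajMeasure`), `Y_0, Y_1, …` its coordinates
(the accepted configurations in order); `|f|, |g| ≤ C` are measurable and `C' = C + |mean|`.
* §1 **A DETERMINISTIC DOMINATION** (`JumpReweight.abs_ratio_sub_le`): for weights
  `0 < a_i ≤ 1`, `|Σ g_i/a_i / Σ 1/a_i − c| ≤ |(1/n) Σ (g_i − c)/a_i|` — a self-normalised mean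
  with weights `1/a_i ≥ 1` is never further from `c` than the plain mean of the reweighted
  residuals — no delta method / Slutsky step (contrast the i.i.d. `SelfNormalisedReweighting*`
  files, whose random denominator needs one): the error is dominated PATHWISE by a linear statistic.
* §2 **THE ACCEPTED STREAM FROM ANY START, AT RATE `ā`** — the tree's any-start Doeblin
  certificates at `κ = J̃`, any `0 < ε ≤ ā`: Gaussian tails
  `P̃_{μ₀}(|(1/N) Σ_{i<N} f(Y_i) − π̃ f| ≥ s) ≤ 2 exp(−(Ns − 4C'/ε)²/(8N C'²/ε²))`
  (`jumpChain_abs_tail_le_exp`, `…_of_centred`); bias `≤ 4C'/(ā N)` (`jumpChain_bias_le`);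
  mean-square error `≤ (2/ā − 1) Var_π̃(f)/N + 16 C'²/(ā N)²` (`jumpChain_mse_le`); and the CLT
  `√N ((1/N) Σ_{i<N} f(Y_i) − π̃ f) ⇒ N(0, σ²_J̃(f))` from every start (`jumpChain_clt`, the
  tree's `markovChain_clt` at `ε = ā/2`).  No floor, no aperiodicity or spectral hypothesis on
  the base chain: the constant is the mean acceptance, whatever the weight.
* §3 **THE SOJOURN-REWEIGHTED ESTIMATOR** `R_N = Σ_{i<N} g(Y_i)/α(Y_i) / Σ_{i<N} 1/α(Y_i)` of a
  TARGET mean `πg` (each accepted configuration weighted by its EXPECTED multiplicity `1/α`, the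
  mean of IV's geometric sojourn — the Rao–Blackwellised time average): `π̃`-means of `F/α` are
  `π`-means over `ā` (VIII), so `u = (g − πg)/α` is `π̃`-centred and, under an acceptance floor
  `α ≥ m` (= weight ceiling), bounded by `C'/m`; by §1 `|R_N − πg| ≤ |(1/N) Σ u(Y_i)|` on EVERY
  path, whence from ANY start `P̃_{μ₀}(|R_N − πg| ≥ s) ≤ 2 exp(−(Ns − 4C'/(mε))²/(8N(C'/m)²/ε²))`
  (`reweighted_abs_tail_le_exp`) and
  `E_{μ₀}(R_N − πg)² ≤ (2/ā − 1)(∫ (g − πg)²/α dπ)/(ā N) + 16 (C'/m)²/(ā N)²` (`reweighted_sq_le`):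
  a finite-`N`, any-start certificate for an estimator of target means built from the accepted
  configurations alone.
* §4 `flowSampler_jump_reweighting`: the exact flow sampler on `SU(n)^E` under the hypotheses of
  `Exactness.flowSampler_exact_doeblin` (uniform Lüscher defect `δ`, every volume; `m = e^{−2δ}`).

Reading (value-free): the accepted configurations of an exact independence / flow sampler,
reweighted by their expected multiplicities, estimate target means with any-start Gaussian
confidence set by the mean acceptance and the floor; at the level of Doeblin certificates this is
NOT sharper than the full-chain bound (`ChainHoeffding`) — the gain from discarding the realised
sojourns is in the variance (VIII `asympVar_indepMH_eq_jump`, whose last term is the sojourn noise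
the reweighting removes), not in the tail constant.  Printed counterparts NAMED ONLY (not used):
Rao–Blackwellised Metropolis multiplicities, Douc–Robert 2011 Lem 1 [galaxy:pdf:-7173847574603489160
p.2]; the jump chain with importance weights [corpus:paper:arxiv-1910.13316 p.4 §3]; jump-chain
variance relations [corpus:paper:arxiv-1609.02541 p.12]; Hoeffding for uniformly ergodic chains,
Glynn–Ormoneit 2002 (tree: `ChainHoeffding`).  NOT CLAIMED: any number of ours (no `δ`, `ā`, `m`,
`α` of a concrete flow or coupling); the cost of evaluating `α` (an integral over the proposal law,
in practice estimated from fresh proposals — the estimated-`α` estimator is not treated); a CLT or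
asymptotic variance for the ratio `R_N`; sharpness of any constant; unbounded `g`; anything
deciding between samplers; continuum statements.
-/

noncomputable section

namespace Summit.Ventures.LatticeQCDFlow.Scoring

open MeasureTheory ProbabilityTheory Filter Finset Summit.Ventures.LatticeQCDFlow.Exactness
open scoped ENNReal Topology

variable {Ω : Type*} [MeasurableSpace Ω]

/-! ### §1 The self-normalised reweighted mean: a deterministic domination -/

/-- **PATHWISE DOMINATION OF A SELF-NORMALISED MEAN.**  For weights `0 < a_i ≤ 1` on a nonempty
finite index set, values `g_i` and a constant `c`:
`|Σ g_i/a_i / Σ 1/a_i − c| ≤ |(Σ (g_i − c)/a_i) / #s|` — because `Σ 1/a_i ≥ #s`. -/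
theorem JumpReweight.abs_ratio_sub_le {ι : Type*} {s : Finset ι} (hs : s.Nonempty) {a : ι → ℝ}
    (ha0 : ∀ i ∈ s, 0 < a i) (ha1 : ∀ i ∈ s, a i ≤ 1) (g : ι → ℝ) (c : ℝ) :
    |(∑ i ∈ s, g i / a i) / (∑ i ∈ s, 1 / a i) - c|
      ≤ |(∑ i ∈ s, (g i - c) / a i) / s.card| := by
  have hcard : (0 : ℝ) < s.card := Nat.cast_pos.2 hs.card_pos
  have hD1 : (s.card : ℝ) ≤ ∑ i ∈ s, 1 / a i := by
    calc (s.card : ℝ) = ∑ i ∈ s, (1 : ℝ) := by simp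
      _ ≤ ∑ i ∈ s, 1 / a i := Finset.sum_le_sum fun i hi => by
          rw [le_div_iff₀ (ha0 i hi), one_mul]; exact ha1 i hi
  have hD : 0 < ∑ i ∈ s, 1 / a i := hcard.trans_le hD1
  have hnum : (∑ i ∈ s, g i / a i) / (∑ i ∈ s, 1 / a i) - c
      = (∑ i ∈ s, (g i - c) / a i) / ∑ i ∈ s, 1 / a i := by
    rw [eq_div_iff hD.ne', sub_mul, div_mul_cancel₀ _ hD.ne', Finset.mul_sum,
      ← Finset.sum_sub_distrib]
    exact Finset.sum_congr rfl fun i _ => by rw [sub_div, mul_one_div]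
  rw [hnum, abs_div, abs_div, abs_of_pos hD, abs_of_pos hcard]
  exact div_le_div_of_nonneg_left (abs_nonneg _) hcard hD1

variable {q : Measure Ω} [IsProbabilityMeasure q] {w : Ω → ℝ} {π : Measure Ω}

/-- **… on a path of accepted configurations** (`a_i = α(Y_i) ∈ (0, 1]`): `|R_N − c| ≤
|(1/N) Σ_{i<N} (g(Y_i) − c)/α(Y_i)|`, `R_N = Σ_{i<N} g(Y_i)/α(Y_i) / Σ_{i<N} 1/α(Y_i)`. -/
theorem JumpReweight.abs_reweighted_sub_le (hw : Measurable w) (hw0 : ∀ x, 0 < w x)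
    (g : Ω → ℝ) (c : ℝ) {N : ℕ} (hN : N ≠ 0) (x : ℕ → Ω) :
    |(∑ i ∈ Finset.range N, g (x i) / (imhAcceptMass q w (x i)).toReal)
          / (∑ i ∈ Finset.range N, 1 / (imhAcceptMass q w (x i)).toReal) - c|
      ≤ |(∑ i ∈ Finset.range N, (g (x i) - c) / (imhAcceptMass q w (x i)).toReal) / N| := by
  have h := JumpReweight.abs_ratio_sub_le (Finset.nonempty_range_iff.2 hN)
    (a := fun i => (imhAcceptMass q w (x i)).toReal)
    (fun i _ => toReal_imhAcceptMass_pos hw hw0 (x i))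
    (fun i _ => toReal_imhAcceptMass_le_one (x i)) (fun i => g (x i)) c
  rwa [Finset.card_range] at h

/-- **The reweighted residual is centred on the accepted rows**: `∫ (g − πg)/α dπ̃ = 0`
(`∫ F/α dπ̃ = (∫ F dπ)/ā`, VIII). -/
theorem JumpReweight.integral_tilt_centredDiv (hw : Measurable w) (hw0 : ∀ x, 0 < w x)
    [IsProbabilityMeasure π] {g : Ω → ℝ} (hg : Integrable g π) :
    ∫ x, (g x - ∫ z, g z ∂π) / (imhAcceptMass q w x).toReal ∂(imhTilt q w π) = 0 := by
  rw [JumpVar.integral_tilt_div hw hw0, integral_sub hg (integrable_const _), integral_const,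
    probReal_univ, one_smul, sub_self, mul_zero]

/-- … and bounded by `(C + |πg|)/m` under an acceptance floor `α ≥ m`. -/
theorem JumpReweight.abs_centredDiv_le (hw : Measurable w) (hw0 : ∀ x, 0 < w x) {m : ℝ}
    (hm0 : 0 < m) (hm : ∀ x, ENNReal.ofReal m ≤ imhAcceptMass q w x) {g : Ω → ℝ} {C : ℝ}
    (hC : ∀ x, |g x| ≤ C) (x : Ω) :
    |(g x - ∫ z, g z ∂π) / (imhAcceptMass q w x).toReal| ≤ (C + |∫ z, g z ∂π|) / m :=
  JumpVar.abs_div_le hw hw0 hm0 hm (g := fun x => g x - ∫ z, g z ∂π)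
    (fun x => (abs_sub _ _).trans (add_le_add (hC x) le_rfl)) x

/-- A Doeblin constant below the mean acceptance: `ε ≤ ā` ⇒ `J̃(x, ·) ≥ ε π̃` (VII). -/
theorem JumpReweight.doeblin_of_le (hw : Measurable w) (hw0 : ∀ x, 0 < w x)
    [IsProbabilityMeasure π] (hπ : (q.withDensity fun x => ENNReal.ofReal (w x)) = π) {ε : ℝ≥0∞}
    (hε : ε ≤ ∫⁻ x, imhAcceptMass q w x ∂π) (x : Ω) {B : Set Ω} (hB : MeasurableSet B) :
    ε * imhTilt q w π B ≤ imhJump q w x B :=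
  (mul_le_mul' hε le_rfl).trans (imhJump_doeblin hw hw0 hπ x hB)

/-! ### §2 The accepted stream from any start: tails, bias, mean-square error, CLT -/

section Path

variable [IsMarkovKernel (imhJump q w)] {μ₀ : Measure Ω} [IsProbabilityMeasure μ₀]

/-- **GAUSSIAN TAILS FOR ACCEPTED-STREAM AVERAGES, ANY START** (`π = w q` a probability law,
`0 < ε ≤ ā`; `|f| ≤ C` measurable, `C' = C + |π̃ f|`; `N ≥ 1`, `Ns ≥ 4C'/ε`):
`P̃_{μ₀}(|(1/N) Σ_{i<N} f(Y_i) − π̃ f| ≥ s) ≤ 2 exp(−(Ns − 4C'/ε)² / (8N C'²/ε²))`. -/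
theorem jumpChain_abs_tail_le_exp (hw : Measurable w) (hw0 : ∀ x, 0 < w x)
    [IsProbabilityMeasure π] (hπ : (q.withDensity fun x => ENNReal.ofReal (w x)) = π) {ε : ℝ≥0∞}
    (hε0 : 0 < ε) (hε : ε ≤ ∫⁻ x, imhAcceptMass q w x ∂π)
    {f : Ω → ℝ} (hf : Measurable f) {C : ℝ} (hC : ∀ x, |f x| ≤ C) {N : ℕ} (hN : N ≠ 0) {s : ℝ}
    (hs : 4 * (C + |∫ z, f z ∂(imhTilt q w π)|) / ε.toReal ≤ N * s) :
    (Kernel.trajMeasure (X := fun _ : ℕ => Ω) μ₀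
          (fun m : ℕ => (imhJump q w).comap
            (fun y : (i : ↥(Finset.Iic m)) → Ω => y ⟨m, Finset.mem_Iic.2 le_rfl⟩)
            (measurable_pi_apply _))).real
        {x | s ≤ |(∑ i ∈ Finset.range N, f (x i)) / N - ∫ z, f z ∂(imhTilt q w π)|}
      ≤ 2 * Real.exp (-(N * s - 4 * (C + |∫ z, f z ∂(imhTilt q w π)|) / ε.toReal) ^ 2
          / (8 * N * (C + |∫ z, f z ∂(imhTilt q w π)|) ^ 2 / ε.toReal ^ 2)) := by
  haveI := isProbabilityMeasure_imhTilt (q := q) (π := π) hw hw0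
  exact chain_abs_tail_le_exp_of_doeblin (imhJump_invariant hw hw0 hπ)
    (fun x B hB => JumpReweight.doeblin_of_le hw hw0 hπ hε x hB) hε0 hf hC hN hs

/-- Centred form (`π̃ f = 0`, `Ns ≥ 4C/ε`):
`P̃_{μ₀}(|(1/N) Σ_{i<N} f(Y_i)| ≥ s) ≤ 2 exp(−(Ns − 4C/ε)²/(8N C²/ε²))`. -/
theorem jumpChain_abs_tail_le_exp_of_centred (hw : Measurable w) (hw0 : ∀ x, 0 < w x)
    [IsProbabilityMeasure π] (hπ : (q.withDensity fun x => ENNReal.ofReal (w x)) = π) {ε : ℝ≥0∞}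
    (hε0 : 0 < ε) (hε : ε ≤ ∫⁻ x, imhAcceptMass q w x ∂π)
    {f : Ω → ℝ} (hf : Measurable f) {C : ℝ} (hC : ∀ x, |f x| ≤ C) {N : ℕ} (hN : N ≠ 0)
    (hf0 : ∫ z, f z ∂(imhTilt q w π) = 0) {s : ℝ} (hs : 4 * C / ε.toReal ≤ N * s) :
    (Kernel.trajMeasure (X := fun _ : ℕ => Ω) μ₀
          (fun m : ℕ => (imhJump q w).comap
            (fun y : (i : ↥(Finset.Iic m)) → Ω => y ⟨m, Finset.mem_Iic.2 le_rfl⟩)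
            (measurable_pi_apply _))).real
        {x | s ≤ |(∑ i ∈ Finset.range N, f (x i)) / N|}
      ≤ 2 * Real.exp (-(N * s - 4 * C / ε.toReal) ^ 2 / (8 * N * C ^ 2 / ε.toReal ^ 2)) := by
  have h := jumpChain_abs_tail_le_exp (μ₀ := μ₀) hw hw0 hπ hε0 hε hf hC hN (s := s)
    (by simpa only [hf0, abs_zero, add_zero] using hs)
  simpa only [hf0, abs_zero, add_zero, sub_zero] using h

/-- **BIAS OF ACCEPTED-STREAM AVERAGES, ANY START**: `|E_{μ₀}[(1/N) Σ_{i<N} f(Y_i)] − π̃ f| ≤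
4C'/(ā N)` (the Poisson solution of `J̃` at rate `ā`, `|h| ≤ 2C'/ā`; no stationarity). -/
theorem jumpChain_bias_le (hw : Measurable w) (hw0 : ∀ x, 0 < w x)
    [IsProbabilityMeasure π] (hπ : (q.withDensity fun x => ENNReal.ofReal (w x)) = π)
    {f : Ω → ℝ} (hf : Measurable f) {C : ℝ} (hC : ∀ x, |f x| ≤ C) {N : ℕ} (hN : N ≠ 0) :
    |∫ x, (∑ i ∈ Finset.range N, f (x i)) / N ∂(Kernel.trajMeasure (X := fun _ : ℕ => Ω) μ₀
          (fun m : ℕ => (imhJump q w).comap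
            (fun y : (i : ↥(Finset.Iic m)) → Ω => y ⟨m, Finset.mem_Iic.2 le_rfl⟩)
            (measurable_pi_apply _))) - ∫ z, f z ∂(imhTilt q w π)|
      ≤ 4 * (C + |∫ z, f z ∂(imhTilt q w π)|) / (∫⁻ x, imhAcceptMass q w x ∂π).toReal / N := by
  haveI := isProbabilityMeasure_imhTilt (q := q) (π := π) hw hw0
  set m := ∫ z, f z ∂(imhTilt q w π) with hm
  have hfc : ∀ x, |f x - m| ≤ C + |m| := fun x => (abs_sub _ _).trans (add_le_add (hC x) le_rfl)
  have hf0 : ∫ x, (f x - m) ∂(imhTilt q w π) = 0 := by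
    rw [integral_sub (integrable_of_bounded _ hf hC) (integrable_const _), integral_const,
      probReal_univ, one_smul, hm, sub_self]
  obtain ⟨h, hhm, hhb, hpois⟩ := poisson_exists_of_doeblin (imhJump_invariant hw hw0 hπ)
    (fun x B hB => JumpReweight.doeblin_of_le hw hw0 hπ le_rfl x hB)
    (pos_iff_ne_zero.2 (lintegral_imhAcceptMass_ne_zero hw hw0)) (hf.sub measurable_const) hfc hf0
  calc _ ≤ 2 * (2 * (C + |m|) / (∫⁻ x, imhAcceptMass q w x ∂π).toReal) / N :=
        chain_bias_le_of_poisson (imhJump q w) μ₀ hhm hhb hpois hN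
    _ = _ := by ring

/-- **MEAN-SQUARE ERROR OF ACCEPTED-STREAM AVERAGES, ANY START**:
`E_{μ₀}((1/N) Σ_{i<N} f(Y_i) − π̃ f)² ≤ (2/ā − 1) Var_π̃(f)/N + 16 C'²/(ā² N²)`. -/
theorem jumpChain_mse_le (hw : Measurable w) (hw0 : ∀ x, 0 < w x)
    [IsProbabilityMeasure π] (hπ : (q.withDensity fun x => ENNReal.ofReal (w x)) = π)
    {f : Ω → ℝ} (hf : Measurable f) {C : ℝ} (hC : ∀ x, |f x| ≤ C) {N : ℕ} (hN : N ≠ 0) :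
    ∫ x, ((∑ i ∈ Finset.range N, f (x i)) / N - ∫ z, f z ∂(imhTilt q w π)) ^ 2
        ∂(Kernel.trajMeasure (X := fun _ : ℕ => Ω) μ₀
          (fun m : ℕ => (imhJump q w).comap
            (fun y : (i : ↥(Finset.Iic m)) → Ω => y ⟨m, Finset.mem_Iic.2 le_rfl⟩)
            (measurable_pi_apply _)))
      ≤ (2 / (∫⁻ x, imhAcceptMass q w x ∂π).toReal - 1)
            * autocov (imhJump q w) (imhTilt q w π)
                (fun y => f y - ∫ z, f z ∂(imhTilt q w π)) 0 / N
          + 16 * (C + |∫ z, f z ∂(imhTilt q w π)|) ^ 2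
              / ((∫⁻ x, imhAcceptMass q w x ∂π).toReal ^ 2 * (N : ℝ) ^ 2) := by
  haveI := isProbabilityMeasure_imhTilt (q := q) (π := π) hw hw0
  exact chain_mse_le_of_doeblin (imhJump_invariant hw hw0 hπ)
    (fun x B hB => JumpReweight.doeblin_of_le hw hw0 hπ le_rfl x hB)
    (pos_iff_ne_zero.2 (lintegral_imhAcceptMass_ne_zero hw hw0)) hf hC hN

/-- **THE CLT FOR ACCEPTED-STREAM AVERAGES, ANY START**: for `Y` with law `N(0, σ²_J̃(f))`,
`σ²_J̃(f) = Var_π̃ f + 2 Σ_{k≥1} Cov_π̃(f, J̃^k f)`: `√N ((1/N) Σ_{i<N} f(Y_i) − π̃ f) ⇒ Y`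
(`markovChain_clt` at `ε = ā/2 < 1`; the binder on `P̃_{μ₀}` is `inferInstance` at call sites). -/
theorem jumpChain_clt (hw : Measurable w) (hw0 : ∀ x, 0 < w x)
    [IsProbabilityMeasure π] (hπ : (q.withDensity fun x => ENNReal.ofReal (w x)) = π)
    {f : Ω → ℝ} (hf : Measurable f) {C : ℝ} (hC : ∀ x, |f x| ≤ C)
    {Ω' : Type*} [MeasurableSpace Ω'] {P' : Measure Ω'} [IsProbabilityMeasure P'] {Y : Ω' → ℝ}
    (hY : HasLaw Y (gaussianReal 0 (Real.toNNReal
      ((∫ y, (f y - ∫ z, f z ∂(imhTilt q w π)) ^ 2 ∂(imhTilt q w π))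
      + 2 * ∑' k, ∫ y, (f y - ∫ z, f z ∂(imhTilt q w π))
          * (kop (imhJump q w))^[k + 1] (fun y => f y - ∫ z, f z ∂(imhTilt q w π)) y
            ∂(imhTilt q w π)))) P')
    [IsProbabilityMeasure (Kernel.trajMeasure (X := fun _ : ℕ => Ω) μ₀
          (fun m : ℕ => (imhJump q w).comap
            (fun y : (i : ↥(Finset.Iic m)) → Ω => y ⟨m, Finset.mem_Iic.2 le_rfl⟩)
            (measurable_pi_apply _)))] :
    TendstoInDistribution (fun (N : ℕ) (x : ℕ → Ω) =>
        (Real.sqrt N)⁻¹ * ∑ t ∈ Finset.range N, (f (x t) - ∫ z, f z ∂(imhTilt q w π)))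
      atTop Y (fun _ => Kernel.trajMeasure (X := fun _ : ℕ => Ω) μ₀
          (fun m : ℕ => (imhJump q w).comap
            (fun y : (i : ↥(Finset.Iic m)) → Ω => y ⟨m, Finset.mem_Iic.2 le_rfl⟩)
            (measurable_pi_apply _))) P' := by
  haveI := isProbabilityMeasure_imhTilt (q := q) (π := π) hw hw0
  have hne0 := lintegral_imhAcceptMass_ne_zero (q := q) (π := π) hw hw0
  have hneT : ∫⁻ x, imhAcceptMass q w x ∂π ≠ ⊤ :=
    ne_top_of_le_ne_top ENNReal.one_ne_top (lintegral_imhAcceptMass_le_one π)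
  have hlt : (∫⁻ x, imhAcceptMass q w x ∂π) / 2 < 1 :=
    (ENNReal.half_lt_self hne0 hneT).trans_le (lintegral_imhAcceptMass_le_one π)
  exact markovChain_clt (κ := imhJump q w) (ν := imhTilt q w π) (imhJump_invariant hw hw0 hπ)
    (fun x B hB => JumpReweight.doeblin_of_le hw hw0 hπ ENNReal.half_le_self x hB)
    (ENNReal.half_pos hne0) hlt hf hC μ₀ hY

/-! ### §3 The sojourn-reweighted estimator of target means, from any start -/

/-- **GAUSSIAN TAILS FOR THE SOJOURN-REWEIGHTED ESTIMATOR, ANY START** (`π = w q` a probability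
law, floor `α ≥ m > 0`, `0 < ε ≤ ā`; `|g| ≤ C` measurable, `C' = C + |πg|`; `N ≥ 1`,
`Ns ≥ 4(C'/m)/ε`): `P̃_{μ₀}(|R_N − πg| ≥ s) ≤ 2 exp(−(Ns − 4(C'/m)/ε)²/(8N (C'/m)²/ε²))`,
`R_N = Σ_{i<N} g(Y_i)/α(Y_i) / Σ_{i<N} 1/α(Y_i)`. -/
theorem reweighted_abs_tail_le_exp (hw : Measurable w) (hw0 : ∀ x, 0 < w x)
    [IsProbabilityMeasure π] (hπ : (q.withDensity fun x => ENNReal.ofReal (w x)) = π)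
    {m : ℝ} (hm0 : 0 < m) (hm : ∀ x, ENNReal.ofReal m ≤ imhAcceptMass q w x) {ε : ℝ≥0∞}
    (hε0 : 0 < ε) (hε : ε ≤ ∫⁻ x, imhAcceptMass q w x ∂π)
    {g : Ω → ℝ} (hg : Measurable g) {C : ℝ} (hC : ∀ x, |g x| ≤ C) {N : ℕ} (hN : N ≠ 0) {s : ℝ}
    (hs : 4 * ((C + |∫ z, g z ∂π|) / m) / ε.toReal ≤ N * s) :
    (Kernel.trajMeasure (X := fun _ : ℕ => Ω) μ₀
          (fun m : ℕ => (imhJump q w).comap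
            (fun y : (i : ↥(Finset.Iic m)) → Ω => y ⟨m, Finset.mem_Iic.2 le_rfl⟩)
            (measurable_pi_apply _))).real
        {x | s ≤ |(∑ i ∈ Finset.range N, g (x i) / (imhAcceptMass q w (x i)).toReal)
            / (∑ i ∈ Finset.range N, 1 / (imhAcceptMass q w (x i)).toReal) - ∫ z, g z ∂π|}
      ≤ 2 * Real.exp (-(N * s - 4 * ((C + |∫ z, g z ∂π|) / m) / ε.toReal) ^ 2
          / (8 * N * ((C + |∫ z, g z ∂π|) / m) ^ 2 / ε.toReal ^ 2)) := by
  set u : Ω → ℝ := fun z => (g z - ∫ y, g y ∂π) / (imhAcceptMass q w z).toReal with hu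
  have hum : Measurable u := JumpVar.measurable_div hw (hg.sub measurable_const)
  have hub : ∀ z, |u z| ≤ (C + |∫ y, g y ∂π|) / m :=
    JumpReweight.abs_centredDiv_le hw hw0 hm0 hm hC
  have hu0 : ∫ z, u z ∂(imhTilt q w π) = 0 :=
    JumpReweight.integral_tilt_centredDiv hw hw0 (integrable_of_bounded π hg hC)
  have htail := jumpChain_abs_tail_le_exp_of_centred (μ₀ := μ₀) hw hw0 hπ hε0 hε hum hub hN hu0 hs
  refine (measureReal_mono fun x hx => ?_).trans htail
  simp only [Set.mem_setOf_eq] at hx ⊢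
  exact hx.trans (JumpReweight.abs_reweighted_sub_le hw hw0 g _ hN x)

/-- **MEAN-SQUARE ERROR OF THE SOJOURN-REWEIGHTED ESTIMATOR, ANY START** (floor `α ≥ m > 0`):
`E_{μ₀}(R_N − πg)² ≤ (2/ā − 1) · (∫ (g − πg)²/α dπ)/(ā N) + 16 (C'/m)²/(ā² N²)`. -/
theorem reweighted_sq_le (hw : Measurable w) (hw0 : ∀ x, 0 < w x)
    [IsProbabilityMeasure π] (hπ : (q.withDensity fun x => ENNReal.ofReal (w x)) = π)
    {m : ℝ} (hm0 : 0 < m) (hm : ∀ x, ENNReal.ofReal m ≤ imhAcceptMass q w x)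
    {g : Ω → ℝ} (hg : Measurable g) {C : ℝ} (hC : ∀ x, |g x| ≤ C) {N : ℕ} (hN : N ≠ 0) :
    ∫ x, ((∑ i ∈ Finset.range N, g (x i) / (imhAcceptMass q w (x i)).toReal)
            / (∑ i ∈ Finset.range N, 1 / (imhAcceptMass q w (x i)).toReal) - ∫ z, g z ∂π) ^ 2
        ∂(Kernel.trajMeasure (X := fun _ : ℕ => Ω) μ₀
          (fun m : ℕ => (imhJump q w).comap
            (fun y : (i : ↥(Finset.Iic m)) → Ω => y ⟨m, Finset.mem_Iic.2 le_rfl⟩)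
            (measurable_pi_apply _)))
      ≤ (2 / (∫⁻ x, imhAcceptMass q w x ∂π).toReal - 1)
            * (((∫⁻ x, imhAcceptMass q w x ∂π).toReal)⁻¹
                * ∫ z, (g z - ∫ y, g y ∂π) ^ 2 / (imhAcceptMass q w z).toReal ∂π) / N
          + 16 * ((C + |∫ z, g z ∂π|) / m) ^ 2
              / ((∫⁻ x, imhAcceptMass q w x ∂π).toReal ^ 2 * (N : ℝ) ^ 2) := by
  set u : Ω → ℝ := fun z => (g z - ∫ y, g y ∂π) / (imhAcceptMass q w z).toReal with hu
  have hum : Measurable u := JumpVar.measurable_div hw (hg.sub measurable_const)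
  have hub : ∀ z, |u z| ≤ (C + |∫ y, g y ∂π|) / m :=
    JumpReweight.abs_centredDiv_le hw hw0 hm0 hm hC
  have hu0 : ∫ z, u z ∂(imhTilt q w π) = 0 :=
    JumpReweight.integral_tilt_centredDiv hw hw0 (integrable_of_bounded π hg hC)
  have hmse := jumpChain_mse_le (μ₀ := μ₀) hw hw0 hπ hum hub hN
  have hauto : autocov (imhJump q w) (imhTilt q w π) (fun y => u y - ∫ z, u z ∂(imhTilt q w π)) 0
      = ((∫⁻ x, imhAcceptMass q w x ∂π).toReal)⁻¹
          * ∫ z, (g z - ∫ y, g y ∂π) ^ 2 / (imhAcceptMass q w z).toReal ∂π := by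
    simp only [autocov, hu0, sub_zero, Function.iterate_zero, id_eq, ← sq]
    exact JumpVar.integral_tilt_div_sq hw hw0 π fun z => g z - ∫ y, g y ∂π
  rw [hauto, hu0, abs_zero, add_zero] at hmse; simp only [sub_zero] at hmse
  have hAm : Measurable fun x : ℕ → Ω => ((∑ i ∈ Finset.range N, u (x i)) / N) ^ 2 :=
    ((Finset.measurable_sum _ fun i _ => hum.comp (measurable_pi_apply i)).div_const _).pow_const 2
  have hAb : ∀ x : ℕ → Ω, |((∑ i ∈ Finset.range N, u (x i)) / N) ^ 2|
      ≤ ((C + |∫ y, g y ∂π|) / m) ^ 2 := fun x => by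
    rw [abs_pow]
    refine pow_le_pow_left₀ (abs_nonneg _) ?_ 2
    rw [abs_div, Nat.abs_cast, div_le_iff₀ (Nat.cast_pos.2 (Nat.pos_of_ne_zero hN))]
    calc |∑ i ∈ Finset.range N, u (x i)| ≤ ∑ i ∈ Finset.range N, |u (x i)| :=
          Finset.abs_sum_le_sum_abs _ _
      _ ≤ ∑ i ∈ Finset.range N, (C + |∫ y, g y ∂π|) / m := Finset.sum_le_sum fun i _ => hub _
      _ = (C + |∫ y, g y ∂π|) / m * N := by rw [Finset.sum_const, Finset.card_range]; ring
  refine le_trans (integral_mono_of_nonneg (ae_of_all _ fun x => sq_nonneg _)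
    (integrable_of_bounded _ hAm hAb) (ae_of_all _ fun x => ?_)) hmse
  exact sq_le_sq.2 (JumpReweight.abs_reweighted_sub_le hw hw0 g _ hN x)

end Path

/-! ### §4 The lattice instance -/

section Lattice
open Literature.MathematicalPhysics.QuantumFieldTheory
open Literature.MathematicalPhysics.QuantumFieldTheory.Luscher2010
open Summit.Ventures.LatticeQCDFlow.TrivializingMaps
open scoped Matrix Matrix.Norms.Frobenius ContDiff
variable {d L n : ℕ} [NeZero L]

/-- **THE SOJOURN-REWEIGHTED ESTIMATOR OF AN EXACT FLOW SAMPLER, ANY START.**  Under the hypotheses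
of `Exactness.flowSampler_exact_doeblin` (smooth action and flow generator on `SU(n)^E`, Lüscher
defect `≤ δ`, proposal `q = (Φ 1)_* D[V]`, `π` = the Boltzmann law): `π = w · q` for a measurable
weight `w > 0`, the accepted stream is a Markov chain (`J̃ = imhJump q w`), and for EVERY initial
law `μ₀` of the accepted stream, every bounded measurable `g` (`|g| ≤ C`, `C' = C + |πg|`), every
`N ≥ 1` and `s` with `Ns ≥ 4 (C'/e^{−2δ})/e^{−2δ}`: `P̃_{μ₀}(|R_N − πg| ≥ s) ≤
2 exp(−(Ns − 4(C'/e^{−2δ})/e^{−2δ})² / (8N (C'/e^{−2δ})²/(e^{−2δ})²))` — at every volume. -/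
theorem flowSampler_jump_reweighting (B : SuBasis n)
    {S : AmbConfig d L n → ℝ} (hS : ContDiff ℝ ∞ S) {F : ℝ → AmbConfig d L n → ℝ}
    (hF : ContDiff ℝ ∞ fun p : ℝ × AmbConfig d L n => F p.1 p.2)
    {Φ} (hΦ : IsFlowMap (fun t W => -linkGrad B (F t) W) Φ) {c : ℝ → ℝ} {δ : ℝ}
    (hδ : ∀ t ∈ Set.Icc (0 : ℝ) 1, ∀ U : GaugeConfig d L (Matrix.specialUnitaryGroup (Fin n) ℂ),
      |luscherL B S t (F t) (WilsonFlow.coeConfig U) - S (WilsonFlow.coeConfig U) - c t| ≤ δ)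
    (q : Measure (GaugeConfig d L (Matrix.specialUnitaryGroup (Fin n) ℂ))) [IsProbabilityMeasure q]
    (hq : q = Measure.map (Φ 1) (trivialMeasure (Matrix.specialUnitaryGroup (Fin n) ℂ) d L))
    {π : Measure (GaugeConfig d L (Matrix.specialUnitaryGroup (Fin n) ℂ))} [IsProbabilityMeasure π]
    (hπB : π = boltzmannMeasure fun U => S (WilsonFlow.coeConfig U)) :
    ∃ w : GaugeConfig d L (Matrix.specialUnitaryGroup (Fin n) ℂ) → ℝ, Measurable w ∧
      (∀ U, 0 < w U) ∧ (q.withDensity fun U => ENNReal.ofReal (w U)) = π ∧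
      IsMarkovKernel (imhJump q w) ∧
      ∀ [IsMarkovKernel (imhJump q w)]
        (μ₀ : Measure (GaugeConfig d L (Matrix.specialUnitaryGroup (Fin n) ℂ)))
        [IsProbabilityMeasure μ₀]
        {g : GaugeConfig d L (Matrix.specialUnitaryGroup (Fin n) ℂ) → ℝ}, Measurable g →
        ∀ {C : ℝ}, (∀ U, |g U| ≤ C) → ∀ {N : ℕ}, N ≠ 0 → ∀ {s : ℝ},
        4 * ((C + |∫ V, g V ∂π|) / Real.exp (-(2 * δ))) / Real.exp (-(2 * δ)) ≤ N * s →
          (Kernel.trajMeasure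
              (X := fun _ : ℕ => GaugeConfig d L (Matrix.specialUnitaryGroup (Fin n) ℂ)) μ₀
              (fun m : ℕ => (imhJump q w).comap
                (fun y : (i : ↥(Finset.Iic m)) →
                    GaugeConfig d L (Matrix.specialUnitaryGroup (Fin n) ℂ) =>
                  y ⟨m, Finset.mem_Iic.2 le_rfl⟩) (measurable_pi_apply _))).real
            {x | s ≤ |(∑ i ∈ Finset.range N, g (x i) / (imhAcceptMass q w (x i)).toReal)
                / (∑ i ∈ Finset.range N, 1 / (imhAcceptMass q w (x i)).toReal) - ∫ V, g V ∂π|}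
          ≤ 2 * Real.exp (-(N * s - 4 * ((C + |∫ V, g V ∂π|) / Real.exp (-(2 * δ)))
                / Real.exp (-(2 * δ))) ^ 2
              / (8 * N * ((C + |∫ V, g V ∂π|) / Real.exp (-(2 * δ))) ^ 2
                / Real.exp (-(2 * δ)) ^ 2)) := by
  obtain ⟨w, hw, hlo, -, hπ, -, hα, -⟩ := flowSampler_exact_doeblin B hS hF hΦ hδ q hq
  rw [← hπB] at hπ
  have hw0 : ∀ U, 0 < w U := fun U => (Real.exp_pos _).trans_le (hlo U)
  have hε0 : 0 < ENNReal.ofReal (Real.exp (-(2 * δ))) := ENNReal.ofReal_pos.2 (Real.exp_pos _)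
  have hε : ENNReal.ofReal (Real.exp (-(2 * δ))) ≤ ∫⁻ V, imhAcceptMass q w V ∂π := by
    refine Eq.trans_le ?_ (lintegral_mono hα)
    rw [lintegral_const, measure_univ, mul_one]
  have he : (ENNReal.ofReal (Real.exp (-(2 * δ)))).toReal = Real.exp (-(2 * δ)) :=
    ENNReal.toReal_ofReal (Real.exp_pos _).le
  refine ⟨w, hw, hw0, hπ, isMarkovKernel_imhJump hw hw0, ?_⟩
  intro _ μ₀ _ g hg C hC N hN s hs
  have h := reweighted_abs_tail_le_exp (μ₀ := μ₀) hw hw0 hπ (Real.exp_pos _) hα hε0 hε hg hC hN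
    (s := s) (by rwa [he])
  rwa [he] at h

end Lattice

end Summit.Ventures.LatticeQCDFlow.Scoring
end
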